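import Literature.Analysis.Asymptotics.LaplaceMethodMultivariate
import Literature.Analysis.UnboundedOperators.DiagonalSemigroupCalculus
import HarnessLib

/-!
# Laplace's method with an EXPLICIT, DIMENSION-POLYNOMIAL remainder `O(1/β)`
# (interior non-degenerate minimum, parity-improved second order)

Helper module (free-hands work of width seat ym-line-sfw-p2-w2 g49, cell ym-idea-1) toward crux
⟨stmt-QuantumFields-24204⟩ `VirialFluxGap.SharpTwistedLaplace` (r301 of route VirialFluxGap; the leaf served by
LINE g15-A route TwistEaterVolume ∕ ⟨24319⟩ TubeVolumeLaw) by the DIRECT Laplace method at the twist-eater orbits: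
the leaf's window `L ≤ β^a` allows `β ≥ poly(L)`, so `log ∫e^{−βF_z}dμ = −9L⁴·log β + C(L,z) ± K·L^q/β` needs a
Laplace remainder with constants POLYNOMIAL IN THE DIMENSION `m = 18L⁴` and of order `1/β` (not `β^{−1/2}`).
The tree's Laplace files (`Literature/Analysis/Asymptotics/LaplaceMethodMultivariate`, `…MorseBottFibred`,
`…Chart`, `…Orbit*`, `…CompactGroup*`) are LIMIT statements at fixed dimension; this module is the quantitative
Euclidean core (the orbit ∕ slice and chart layers with `poly(L)` constants are the remaining steps, to be
consumed with it exactly as with the limit form).  Everything here is PROVED; no definitions, no named facts;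
pure real analysis (namespace `Summit.QuantumFields.YangMills.Theorems.QuantitativeLaplace`).
THIS FILE = PART 1/3 (§1 elementary inequalities, §2 Gaussian integrals ∕ moment bounds ∕ odd integrands); parts 2/3 (pointwise bounds on the ball) and 3/3 (tail, remainder integral, ★★ `laplaceMethod_quantitative`) are the sibling modules `…QuantitativeLaplacePointwise` ∕ `…QuantitativeLaplaceMethod`.

THE STATEMENT (★★ `laplaceMethod_quantitative`, consumer form `laplaceMethod_quantitative_of_eqOn`).
`V` a real inner product space of dimension `m`, Lebesgue measure; `A` symmetric with `λ‖y‖² ≤ ⟪Ay, y⟫`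
(`λ > 0`); on the closed ball `‖y‖ ≤ R` a phase `f = ½⟪Ay,y⟫ + c + r` and a weight `w = w₀(1 + ℓ + e)` with
`c`, `ℓ` ODD (`c(−y) = −c(y)`, `ℓ(−y) = −ℓ(y)`; e.g. the cubic Taylor form of the phase and the linear Taylor
form of the weight), `|c| ≤ A₃‖y‖³`, `|r| ≤ A₄‖y‖⁴`, `|ℓ| ≤ D‖y‖`, `|e| ≤ G‖y‖²` on the ball
(`A₃, A₄, D, G ≥ 0`, `c, r, ℓ, e` measurable), and the smallness of the window
`A₃R + A₄R² ≤ λ/(8(m+8))`, `DR ≤ 1`, `GR² ≤ 1`.  THEN for every `β > 0`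

  `|∫_{‖y‖≤R} e^{−βf} w dy − w₀𝔊(β)| ≤ (K/β)·w₀𝔊(β)`,  `𝔊(β) = (2π/β)^{m/2}/√det A`,

with the EXPLICIT constant
`K = 16(m+8)/(λR²) + 16G(m+8)/λ + 256(A₄ + (A₃+A₄R)(D+GR))(m+8)²/λ² + 18432(A₃+A₄R)²(m+8)³/λ³`
— polynomial in the dimension and in the data; no hypothesis couples `β` to the data (the tail off the
ball is paid by the linear Markov bound `1 ≤ 2q/(λR²)`, at the price `16(m+8)/(λR²β)`).  The first-order
terms `−βc + ℓ` are odd and integrate to zero against the even Gaussian on the symmetric ball, which is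
why the remainder is `O(1/β)` and not `O(β^{−1/2})` (the integer-power structure of the Laplace expansion
at an interior non-degenerate critical point); the second-order terms are bounded by Gaussian moments,
estimated by the pointwise bound `qᵏe^{−εβq} ≤ k!/(εβ)ᵏ` (`ε = 1/(4(m+8))`) at the price of the factor
`(1 − 1/(2(m+8)))^{−m/2} ≤ 2`, so that no constant exponential in `m` appears.  Structure of the proof:
§1 elementary inequalities; §2 the scaled anisotropic Gaussian `∫e^{−s·½⟪Ay,y⟫} = (2π/s)^{m/2}/√det A`,
the moment bound `integral_pow_mul_exp_neg_le`, the odd-integrand lemma; §3 the pointwise second-order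
bound on the ball (`laplace_pointwise_remainder_le`), the tail (`laplace_tail_le`), the remainder integral
(`laplace_remainder_integral_le`), assembly.

WHY (the use).  «`β → ∞` at a box that GROWS with `β`» statements (e.g. Laplace windows `L ≤ β^a` of
lattice partition functions, where the number of integration variables is polynomial in `L`) need the
Laplace remainder with constants explicit in the dimension; the tree's limit theorems
(`tendsto_laplaceMethod`, `…_fibred`, `…_orbit`) fix the dimension.  This file is the Euclidean core; the
orbit ∕ chart layers are consumed with it exactly as with the limit form.

HONEST FRAMING: classical real analysis; width 0 by itself toward any lattice statement; ⟨24204⟩, ⟨24319⟩ and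
every rung stay OPEN; the Yang–Mills mass gap (Clay) is NOT touched; no summit is proved by a line.

## References
* K. W. Breitung, *Asymptotic Approximations for Probability Integrals*, LNM 1592 (1994), Lemma 26 p. 30,
  Thm 41 p. 56 (leading order; the proof (5.29)–(5.36) made quantitative here). [Breitung1994]
* R. Wong, *Asymptotic Approximations of Integrals*, SIAM Classics 34 (2001), §IX.5 (expansion in INTEGER
  powers of `1/λ` at an interior non-degenerate critical point: odd terms vanish). [Wong2001AsymptoticApproximationsIntegrals]
-/

noncomputable section

open _root_.MeasureTheory _root_.Filter _root_.Set _root_.Module _root_.Metric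
open scoped _root_.Topology _root_.Real _root_.InnerProductSpace

namespace Summit.QuantumFields.YangMills.Theorems.QuantitativeLaplace

open Literature.Analysis.Asymptotics
open Literature.Analysis.UnboundedOperators (abs_exp_sub_one_sub_le_sq_mul_exp_abs)

/-! ## §1 Elementary real inequalities (`|e^u − 1 − u| ≤ u²e^{|u|}` is the tree's
`Literature.Analysis.UnboundedOperators.abs_exp_sub_one_sub_le_sq_mul_exp_abs`) -/

/-- `xᵏ e^{−ax} ≤ k!/aᵏ` for `x ≥ 0`, `a > 0` (from `(ax)ᵏ/k! ≤ e^{ax}`). [folklore] -/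
theorem pow_mul_exp_neg_mul_le (k : ℕ) {a x : ℝ} (ha : 0 < a) (hx : 0 ≤ x) :
    x ^ k * Real.exp (-(a * x)) ≤ k.factorial / a ^ k := by
  have h := Real.pow_div_factorial_le_exp (a * x) (by positivity) k
  have hk : (0 : ℝ) < k.factorial := by exact_mod_cast k.factorial_pos
  have hak : 0 < a ^ k := pow_pos ha k
  rw [mul_pow] at h
  rw [Real.exp_neg, le_div_iff₀ hak]
  have : a ^ k * x ^ k ≤ k.factorial * Real.exp (a * x) := by
    rwa [div_le_iff₀ hk, mul_comm (Real.exp _)] at h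
  calc x ^ k * (Real.exp (a * x))⁻¹ * a ^ k = (a ^ k * x ^ k) * (Real.exp (a * x))⁻¹ := by ring
    _ ≤ (k.factorial * Real.exp (a * x)) * (Real.exp (a * x))⁻¹ :=
        mul_le_mul_of_nonneg_right this (inv_nonneg.mpr (Real.exp_pos _).le)
    _ = k.factorial := by field_simp

/-- The dimension factor of the moment bounds: `(1 − 1/(2(m+8)))^{−m/2} ≤ 2`. [folklore] -/
theorem inv_one_sub_rpow_half_le_two (m : ℕ) :
    ((1 - 1 / (2 * ((m : ℝ) + 8)))⁻¹) ^ ((m : ℝ) / 2) ≤ 2 := by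
  set x : ℝ := 1 / (2 * ((m : ℝ) + 8)) with hx
  have hm : (0 : ℝ) ≤ m := Nat.cast_nonneg m
  have hx0 : 0 < x := by rw [hx]; positivity
  have hx1 : x ≤ 1 / 16 := by
    rw [hx]
    exact one_div_le_one_div_of_le (by norm_num) (by linarith)
  have hxm : x * m ≤ 1 / 2 := by
    rw [hx, div_mul_eq_mul_div, one_mul, div_le_iff₀ (by positivity)]
    linarith
  -- `(1 − x)⁻¹ ≤ 1 + 2x ≤ e^{2x}`
  have h1 : (1 - x)⁻¹ ≤ Real.exp (2 * x) := by
    have h1x : 0 < 1 - x := by linarith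
    rw [inv_le_iff_one_le_mul₀ h1x]
    have : 1 + 2 * x ≤ Real.exp (2 * x) := by linarith [Real.add_one_le_exp (2 * x)]
    nlinarith [Real.exp_pos (2 * x)]
  have h0 : 0 ≤ (1 - x)⁻¹ := inv_nonneg.mpr (by linarith)
  calc ((1 - x)⁻¹) ^ ((m : ℝ) / 2) ≤ (Real.exp (2 * x)) ^ ((m : ℝ) / 2) :=
        Real.rpow_le_rpow h0 h1 (by positivity)
    _ = Real.exp (x * m) := by rw [← Real.exp_mul]; congr 1; ring
    _ ≤ Real.exp (1 / 2) := Real.exp_le_exp.mpr hxm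
    _ ≤ 2 := by
        have h2 : Real.exp (1 / 2 : ℝ) ^ 2 = Real.exp 1 := by
          rw [← Real.exp_nat_mul]; norm_num
        nlinarith [Real.exp_pos (1 / 2 : ℝ), h2, Real.exp_one_lt_d9]

/-! ## §2 Gaussian integrals and moment bounds for `q = ½⟪Ay, y⟫` -/

section Gauss

variable {V : Type*} [NormedAddCommGroup V] [InnerProductSpace ℝ V] [FiniteDimensional ℝ V]
  [MeasurableSpace V] [BorelSpace V]
variable {A : V →ₗ[ℝ] V} {lam : ℝ}

omit [FiniteDimensional ℝ V] [MeasurableSpace V] [BorelSpace V] in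
/-- Coercivity `λ‖y‖² ≤ ⟪Ay,y⟫` with `λ > 0` gives positivity off the origin. [folklore] -/
theorem inner_pos_of_coercive (hlam : 0 < lam) (hcoer : ∀ y : V, lam * ‖y‖ ^ 2 ≤ ⟪A y, y⟫_ℝ) :
    ∀ y : V, y ≠ 0 → 0 < ⟪A y, y⟫_ℝ := fun y hy =>
  lt_of_lt_of_le (mul_pos hlam (by positivity)) (hcoer y)

omit [FiniteDimensional ℝ V] [MeasurableSpace V] [BorelSpace V] in
/-- `0 ≤ ½⟪Ay,y⟫` under coercivity. [folklore] -/
theorem half_inner_nonneg_of_coercive (hlam : 0 < lam) (hcoer : ∀ y : V, lam * ‖y‖ ^ 2 ≤ ⟪A y, y⟫_ℝ)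
    (y : V) : 0 ≤ (1 / 2) * ⟪A y, y⟫_ℝ := by
  have := hcoer y
  have : 0 ≤ lam * ‖y‖ ^ 2 := by positivity
  linarith

omit [FiniteDimensional ℝ V] [MeasurableSpace V] [BorelSpace V] in
/-- `‖y‖² ≤ (2/λ) · ½⟪Ay,y⟫` under coercivity. [folklore] -/
theorem norm_sq_le_of_coercive (hlam : 0 < lam) (hcoer : ∀ y : V, lam * ‖y‖ ^ 2 ≤ ⟪A y, y⟫_ℝ)
    (y : V) : ‖y‖ ^ 2 ≤ (2 / lam) * ((1 / 2) * ⟪A y, y⟫_ℝ) := by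
  have := hcoer y
  rw [div_mul_eq_mul_div, le_div_iff₀ hlam]
  linarith

omit [MeasurableSpace V] [BorelSpace V] in
/-- The quadratic form `y ↦ ½⟪Ay, y⟫` is continuous. [folklore] -/
theorem continuous_half_inner (A : V →ₗ[ℝ] V) : Continuous fun y : V => (1 / 2) * ⟪A y, y⟫_ℝ :=
  continuous_const.mul ((A.continuous_of_finiteDimensional).inner continuous_id)

/-- **Scaled anisotropic Gaussian**: `∫ e^{−s·½⟪Ay,y⟫} dy = (2π/s)^{m/2}/√det A` (`s > 0`).
[cite: Breitung1994, Lemma 26 (2.102), p. 30] -/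
theorem integral_exp_neg_mul_half_inner (hA : A.IsSymmetric) (hlam : 0 < lam)
    (hcoer : ∀ y : V, lam * ‖y‖ ^ 2 ≤ ⟪A y, y⟫_ℝ) {s : ℝ} (hs : 0 < s) :
    ∫ y : V, Real.exp (-(s * ((1 / 2) * ⟪A y, y⟫_ℝ))) =
      (2 * π / s) ^ ((finrank ℝ V : ℝ) / 2) / Real.sqrt (LinearMap.det A) := by
  have hpos := inner_pos_of_coercive hlam hcoer
  have hsA : (s • A).IsSymmetric := hA.smul (by simp)
  have hspos : ∀ y : V, y ≠ 0 → 0 < ⟪(s • A) y, y⟫_ℝ := fun y hy => by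
    rw [LinearMap.smul_apply, real_inner_smul_left]; exact mul_pos hs (hpos y hy)
  have h := integral_exp_neg_half_inner_self' hsA hspos
  have hfun : (fun y : V => Real.exp (-(s * ((1 / 2) * ⟪A y, y⟫_ℝ)))) =
      fun y => Real.exp (-(1 / 2) * ⟪(s • A) y, y⟫_ℝ) := by
    funext y; rw [LinearMap.smul_apply, real_inner_smul_left]; congr 1; ring
  have hdet : 0 ≤ LinearMap.det A := (det_pos_of_inner_pos hA hpos).le
  rw [hfun, h, LinearMap.det_smul, Real.sqrt_mul' _ hdet, Real.sqrt_eq_rpow, ← Real.rpow_natCast,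
    ← Real.rpow_mul hs.le, Real.div_rpow (by positivity) hs.le, div_div]
  congr 2
  ring

/-- The scaled Gaussian is integrable. [cite: Breitung1994, Lemma 39 p. 55] -/
theorem integrable_exp_neg_mul_half_inner (hlam : 0 < lam)
    (hcoer : ∀ y : V, lam * ‖y‖ ^ 2 ≤ ⟪A y, y⟫_ℝ) {s : ℝ} (hs : 0 < s) :
    Integrable (fun y : V => Real.exp (-(s * ((1 / 2) * ⟪A y, y⟫_ℝ)))) := by
  have hmeas : AEStronglyMeasurable (fun y : V => Real.exp (-(s * ((1 / 2) * ⟪A y, y⟫_ℝ)))) volume :=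
    (Real.continuous_exp.comp ((continuous_const.mul (continuous_half_inner A)).neg)).aestronglyMeasurable
  refine (integrable_exp_neg_mul_norm_sq (V := V) (c := s * lam / 2) (by positivity)).mono hmeas
    (Eventually.of_forall fun y => ?_)
  rw [Real.norm_eq_abs, Real.norm_eq_abs, abs_of_pos (Real.exp_pos _), abs_of_pos (Real.exp_pos _),
    Real.exp_le_exp]
  have := hcoer y
  nlinarith

/-- **Gaussian moment bound, dimension-explicit**: for `1 − 1/(4(m+8)) ≤ t`, `β > 0`, `k : ℕ`,
`∫ qᵏ e^{−tβq} dy ≤ 2 · k! · (4(m+8)/β)ᵏ · 𝔊(β)`, `q = ½⟪Ay,y⟫`, `𝔊(β) = (2π/β)^{m/2}/√det A`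
(pointwise `qᵏe^{−εβq} ≤ k!/(εβ)ᵏ` with `ε = 1/(4(m+8))`, then the Gaussian at `t₀ = 1 − 1/(2(m+8))`
and `t₀^{−m/2} ≤ 2`). [cite: Breitung1994, Lemma 39–40 p. 55] -/
theorem integral_pow_mul_exp_neg_le (hA : A.IsSymmetric) (hlam : 0 < lam)
    (hcoer : ∀ y : V, lam * ‖y‖ ^ 2 ≤ ⟪A y, y⟫_ℝ) (k : ℕ) {β t : ℝ} (hβ : 0 < β)
    (ht : 1 - 1 / (4 * ((finrank ℝ V : ℝ) + 8)) ≤ t) :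
    ∫ y : V, ((1 / 2) * ⟪A y, y⟫_ℝ) ^ k * Real.exp (-(t * β * ((1 / 2) * ⟪A y, y⟫_ℝ))) ≤
      2 * k.factorial * (4 * ((finrank ℝ V : ℝ) + 8) / β) ^ k *
        ((2 * π / β) ^ ((finrank ℝ V : ℝ) / 2) / Real.sqrt (LinearMap.det A)) := by
  set m : ℕ := finrank ℝ V with hm
  set ε : ℝ := 1 / (4 * ((m : ℝ) + 8)) with hε
  set t₀ : ℝ := 1 - 1 / (2 * ((m : ℝ) + 8)) with ht₀
  have hm0 : (0 : ℝ) ≤ m := Nat.cast_nonneg m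
  have hε0 : 0 < ε := by rw [hε]; positivity
  have ht₀pos : 0 < t₀ := by
    rw [ht₀]
    have : 1 / (2 * ((m : ℝ) + 8)) ≤ 1 / 16 := one_div_le_one_div_of_le (by norm_num) (by linarith)
    linarith
  have htε : t₀ ≤ t - ε := by
    rw [ht₀, hε]
    have : 1 / (2 * ((m : ℝ) + 8)) = 1 / (4 * ((m : ℝ) + 8)) + 1 / (4 * ((m : ℝ) + 8)) := by
      field_simp; ring
    linarith
  have hpos := inner_pos_of_coercive hlam hcoer
  have hdet : 0 < LinearMap.det A := det_pos_of_inner_pos hA hpos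
  set G : ℝ := (2 * π / β) ^ ((m : ℝ) / 2) / Real.sqrt (LinearMap.det A) with hG
  have hGpos : 0 < G := by rw [hG]; positivity
  -- pointwise bound
  have hpt : ∀ y : V, ((1 / 2) * ⟪A y, y⟫_ℝ) ^ k * Real.exp (-(t * β * ((1 / 2) * ⟪A y, y⟫_ℝ))) ≤
      (k.factorial / (ε * β) ^ k) * Real.exp (-((t₀ * β) * ((1 / 2) * ⟪A y, y⟫_ℝ))) := by
    intro y
    set q := (1 / 2) * ⟪A y, y⟫_ℝ with hq
    have hq0 : 0 ≤ q := half_inner_nonneg_of_coercive hlam hcoer y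
    have h1 : q ^ k * Real.exp (-((ε * β) * q)) ≤ k.factorial / (ε * β) ^ k :=
      pow_mul_exp_neg_mul_le k (by positivity) hq0
    have h2 : Real.exp (-((t - ε) * β * q)) ≤ Real.exp (-((t₀ * β) * q)) := by
      rw [Real.exp_le_exp]
      have : t₀ * β * q ≤ (t - ε) * β * q := by
        apply mul_le_mul_of_nonneg_right _ hq0
        exact mul_le_mul_of_nonneg_right htε hβ.le
      linarith
    have hsplit : Real.exp (-(t * β * q)) = Real.exp (-((ε * β) * q)) * Real.exp (-((t - ε) * β * q)) := by
      rw [← Real.exp_add]; congr 1; ring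
    calc q ^ k * Real.exp (-(t * β * q))
        = (q ^ k * Real.exp (-((ε * β) * q))) * Real.exp (-((t - ε) * β * q)) := by rw [hsplit]; ring
      _ ≤ (k.factorial / (ε * β) ^ k) * Real.exp (-((t₀ * β) * q)) :=
          mul_le_mul h1 h2 (Real.exp_pos _).le (by positivity)
  -- integrate
  have hint : Integrable (fun y : V => (k.factorial / (ε * β) ^ k) *
      Real.exp (-((t₀ * β) * ((1 / 2) * ⟪A y, y⟫_ℝ)))) :=
    (integrable_exp_neg_mul_half_inner hlam hcoer (by positivity)).const_mul _
  have hle : ∫ y : V, ((1 / 2) * ⟪A y, y⟫_ℝ) ^ k * Real.exp (-(t * β * ((1 / 2) * ⟪A y, y⟫_ℝ))) ≤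
      ∫ y : V, (k.factorial / (ε * β) ^ k) * Real.exp (-((t₀ * β) * ((1 / 2) * ⟪A y, y⟫_ℝ))) :=
    integral_mono_of_nonneg (Eventually.of_forall fun y => by
        have := half_inner_nonneg_of_coercive hlam hcoer y
        positivity) hint (Eventually.of_forall hpt)
  rw [integral_const_mul, integral_exp_neg_mul_half_inner hA hlam hcoer (by positivity)] at hle
  -- the constant
  have hG' : (2 * π / (t₀ * β)) ^ ((m : ℝ) / 2) / Real.sqrt (LinearMap.det A) = (t₀⁻¹) ^ ((m : ℝ) / 2) * G := by
    rw [hG, ← mul_div_assoc, ← Real.mul_rpow (inv_nonneg.mpr ht₀pos.le) (by positivity)]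
    congr 2
    field_simp
  have ht₀inv : (t₀⁻¹) ^ ((m : ℝ) / 2) ≤ 2 := by
    rw [ht₀]; exact inv_one_sub_rpow_half_le_two m
  have hεβ : (k.factorial : ℝ) / (ε * β) ^ k = k.factorial * (4 * ((m : ℝ) + 8) / β) ^ k := by
    rw [hε, div_eq_mul_inv, ← inv_pow]
    congr 2
    field_simp
  calc ∫ y : V, ((1 / 2) * ⟪A y, y⟫_ℝ) ^ k * Real.exp (-(t * β * ((1 / 2) * ⟪A y, y⟫_ℝ)))
      ≤ (k.factorial / (ε * β) ^ k) * ((2 * π / (t₀ * β)) ^ ((m : ℝ) / 2) / Real.sqrt (LinearMap.det A)) := hle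
    _ = k.factorial * (4 * ((m : ℝ) + 8) / β) ^ k * ((t₀⁻¹) ^ ((m : ℝ) / 2) * G) := by rw [hG', hεβ]
    _ ≤ k.factorial * (4 * ((m : ℝ) + 8) / β) ^ k * (2 * G) := by
        gcongr
    _ = 2 * k.factorial * (4 * ((m : ℝ) + 8) / β) ^ k * G := by ring

/-- `qᵏ e^{−sq}` is integrable for every `s > 0`, `q = ½⟪Ay,y⟫`. [cite: Breitung1994, Lemma 39 p. 55] -/
theorem integrable_pow_mul_exp_neg_mul_half_inner (hlam : 0 < lam)
    (hcoer : ∀ y : V, lam * ‖y‖ ^ 2 ≤ ⟪A y, y⟫_ℝ) (k : ℕ) {s : ℝ} (hs : 0 < s) :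
    Integrable (fun y : V => ((1 / 2) * ⟪A y, y⟫_ℝ) ^ k * Real.exp (-(s * ((1 / 2) * ⟪A y, y⟫_ℝ)))) := by
  have hmeas : AEStronglyMeasurable
      (fun y : V => ((1 / 2) * ⟪A y, y⟫_ℝ) ^ k * Real.exp (-(s * ((1 / 2) * ⟪A y, y⟫_ℝ)))) volume :=
    (((continuous_half_inner A).pow k).mul
      (Real.continuous_exp.comp ((continuous_const.mul (continuous_half_inner A)).neg))).aestronglyMeasurable
  refine ((integrable_exp_neg_mul_half_inner hlam hcoer (half_pos hs)).const_mul
    (k.factorial / (s / 2) ^ k)).mono hmeas (Eventually.of_forall fun y => ?_)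
  set q := (1 / 2) * ⟪A y, y⟫_ℝ with hq
  have hq0 : 0 ≤ q := half_inner_nonneg_of_coercive hlam hcoer y
  have h1 : q ^ k * Real.exp (-((s / 2) * q)) ≤ k.factorial / (s / 2) ^ k :=
    pow_mul_exp_neg_mul_le k (half_pos hs) hq0
  rw [Real.norm_eq_abs, Real.norm_eq_abs, abs_of_nonneg (by positivity), abs_of_nonneg (by positivity)]
  have hsplit : Real.exp (-(s * q)) = Real.exp (-((s / 2) * q)) * Real.exp (-((s / 2) * q)) := by
    rw [← Real.exp_add]; congr 1; ring
  calc q ^ k * Real.exp (-(s * q)) = (q ^ k * Real.exp (-((s / 2) * q))) * Real.exp (-((s / 2) * q)) := by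
        rw [hsplit]; ring
    _ ≤ (k.factorial / (s / 2) ^ k) * Real.exp (-((s / 2) * q)) :=
        mul_le_mul_of_nonneg_right h1 (Real.exp_pos _).le

/-- The integral of an ODD function over a centred ball vanishes. [folklore] -/
theorem setIntegral_closedBall_eq_zero_of_odd {φ : V → ℝ} (hodd : ∀ y, φ (-y) = -φ y) (R : ℝ) :
    ∫ y in closedBall (0 : V) R, φ y = 0 := by
  rw [← integral_indicator measurableSet_closedBall]
  set ψ : V → ℝ := (closedBall (0 : V) R).indicator φ with hψ
  have hψodd : ∀ y, ψ (-y) = -ψ y := by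
    intro y
    by_cases hy : y ∈ closedBall (0 : V) R
    · have hy' : -y ∈ closedBall (0 : V) R := by simpa using hy
      rw [hψ, indicator_of_mem hy', indicator_of_mem hy, hodd]
    · have hy' : -y ∉ closedBall (0 : V) R := by simpa using hy
      rw [hψ, indicator_of_notMem hy', indicator_of_notMem hy, neg_zero]
  have hneg : ∫ y, ψ (-y) = ∫ y, ψ y := by
    have h := (LinearIsometryEquiv.neg ℝ (E := V)).measurePreserving.integral_comp
      (LinearIsometryEquiv.neg ℝ (E := V)).toHomeomorph.measurableEmbedding ψ
    simpa using h
  have h1 : ∫ y, ψ (-y) = -∫ y, ψ y := by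
    simp_rw [hψodd]
    rw [integral_neg]
  linarith

end Gauss

end Summit.QuantumFields.YangMills.Theorems.QuantitativeLaplace
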